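import Literature.NumberTheory.Automorphic.UnitaryGroupPairCharactersDet
import Literature.NumberTheory.Automorphic.UnitaryGroupAdelicCharactersDet
import Literature.NumberTheory.Automorphic.UnitaryGroupAdelicDiagSection
import HarnessLib

/-!
# Central characters of `U(V ⊗ W)(𝔸_{L⁺})` factor through `det`: rank `3 = 3 · 1`, CM case — the predicate discharged

[GelbartRogawski1991, §3.1 Remark p. 457 L9–13], printed for `G = U(3)`: "if `s*` is any other compatible splitting, then
`s* = s ⊗ ν′`, where `ν′` is an automorphic character of `E¹`, regarded as a character of `G`" — i.e. every continuous character
of `G(𝔸)` trivial on `G(F)` is `ν′ ∘ det`.  The tree DISPLAYS this as the predicate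
`Liu2021.Def411WeilCarriersDoubling.CentralCharFactorsThroughDet F E c N M e J_V J_W hd`
(`Def411WeilCarriersSplittingDictionary`, the `hA` input of `exists_eq_chiSplittingLine_of_isCompatible`).  Here it is PROVED,
with no residual hypothesis, for a CM field `L`, a real nonsingular diagonal `J_V = diag dV` of rank `3`, a real nonzero
hermitian line `J_W` and any enumeration `e : Fin 3 × Fin 1 ≃ Fin 3`:

* `UnitaryGroup.AdelicCharactersDet.centralCharFactorsThroughDet_rank_three`.

Assembly, nothing else: `reindex e (diag dV ⊗ J_W) = diag d` (`reindex_kronecker_diagonal`, `eq_diagonal_of_fin_one`); on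
`U(diag d)(𝔸_{L⁺})` every continuous character kills `SU` at every place and factors through `det` along any section
(`UnitaryGroup.AdelicCharactersDet.eq_comp_sec_comp_adelicDet` — finite places: `SU(3)` of an isotropic form is generated by
root groups, local isotropy by `HermitianLocal.exists_isotropic_localRing_cm`; complex places: commutators of `U(p, q)`); the
diagonal section `u ↦ diag(u, 1, 1)` is continuous and takes principal idèles to rational points (`UnitaryGroup.adelicDiagSection`,
`continuous_adelicDiagSection`, `adelicDiagSection_mem_range_toAdelic`); and the pair adapter
`UnitaryGroup.centralCharFactorsThroughDet_of_adelic` (continuity, automorphy, unitarity of `α = χ ∘ sec`).  Kernel only: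
0 records, 0 named facts, 0 sorry.
-/

set_option autoImplicit false

noncomputable section

open scoped Matrix Kronecker
open NumberField
open Literature.NumberTheory.GelbartRogawski1991.GRConstruction

namespace Literature.NumberTheory.Automorphic.UnitaryGroup.AdelicCharactersDet

variable (L : Type) [Field L] [NumberField L] [IsCMField L]

/-- **X3-Char item (A) in the pair currency, rank `3 = 3 · 1`, CM case — NO residual hypothesis.**  For a CM field `L`, a real
nonsingular diagonal `J_V = diag dV` of rank `3`, a real nonzero hermitian line `J_W` (`1 × 1`) and any enumeration
`e : Fin 3 × Fin 1 ≃ Fin 3`, the displayed predicate `CentralCharFactorsThroughDet L⁺ L c̄ 3 1 e (diag dV) J_W hd` HOLDS: every continuous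
character of `G₁(𝔸_{L⁺}) = U(J_V ⊗ J_W)(𝔸_{L⁺})` trivial on `G₁(L⁺)` is `α ∘ det` for a continuous unitary automorphic `α`.  Assembly of
`eq_comp_sec_comp_adelicDet` (`SU(3)` is killed at every place) along the diagonal section `adelicDiagSection … 0` through the pair adapter
`centralCharFactorsThroughDet_of_adelic`. [cite: GelbartRogawski1991, §3.1 Remark p. 457 L9–13] -/
theorem centralCharFactorsThroughDet_rank_three (e₁ : Fin 3 × Fin 1 ≃ Fin 3) (dV : Fin 3 → L)
    (hdV : ∀ i, IsCMField.complexConj L (dV i) = dV i) (hdV0 : ∀ i, dV i ≠ 0) (JW : Matrix (Fin 1) (Fin 1) L)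
    (hJW : IsCMField.complexConj L (JW 0 0) = JW 0 0) (hJW0 : JW 0 0 ≠ 0)
    (hd : (Matrix.reindex e₁ e₁ (Matrix.diagonal dV ⊗ₖ JW)).det ≠ 0) :
    Liu2021.Def411WeilCarriersDoubling.CentralCharFactorsThroughDet (Fp L) L (IsCMField.complexConj L) 3 1 e₁
      (Matrix.diagonal dV) JW hd := by
  have hJ₀ : Matrix.reindex e₁ e₁ (Matrix.diagonal dV ⊗ₖ JW) =
      Matrix.diagonal fun k => dV (e₁.symm k).1 * JW 0 0 := by
    conv_lhs => rw [eq_diagonal_of_fin_one L JW]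
    exact reindex_kronecker_diagonal L 3 1 e₁ dV fun _ => JW 0 0
  have hdreal : ∀ k, IsCMField.complexConj L (dV (e₁.symm k).1 * JW 0 0) = dV (e₁.symm k).1 * JW 0 0 := fun k => by
    rw [map_mul, hdV, hJW]
  have hd0' : ∀ k, dV (e₁.symm k).1 * JW 0 0 ≠ 0 := fun k => mul_ne_zero (hdV0 _) hJW0
  have hdet : (Matrix.diagonal fun k => dV (e₁.symm k).1 * JW 0 0).det ≠ 0 := by
    rw [← hJ₀]; exact hd
  exact centralCharFactorsThroughDet_of_adelic (Fp L) L (IsCMField.complexConj L) 3 1 e₁ (Matrix.diagonal dV) JW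
    (Algebra.IsQuadraticExtension.finrank_eq_two _ L) (IsCMField.complexConj_ne_one (K := L)) hd hJ₀ hdet
    (adelicDiagSection (Fp L) L (IsCMField.complexConj L) 3 _ 0)
    (continuous_adelicDiagSection (Fp L) L (IsCMField.complexConj L) 3 _ 0)
    (adelicDiagSection_mem_range_toAdelic (Fp L) L (IsCMField.complexConj L) 3 _ 0)
    fun χ hχ => eq_comp_sec_comp_adelicDet L _ hdreal hd0' hdet _
      (adelicDet_adelicDiagSection (Fp L) L (IsCMField.complexConj L) 3 _ 0 hdet) χ hχ

/-- the same for the hermitian line given REALLY: `J_W = T_W ⊗ 1` with `T_W ∈ M₁(L⁺)`, `det T_W` a unit (the line Gram datum of the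
pin's `splittingDatum`; realness and non-vanishing of `J_W 0 0` are then automatic). [cite: GelbartRogawski1991, §3.1 Remark p. 457 L9–13] -/
theorem centralCharFactorsThroughDet_rank_three_of_map (e₁ : Fin 3 × Fin 1 ≃ Fin 3) (dV : Fin 3 → L)
    (hdV : ∀ i, IsCMField.complexConj L (dV i) = dV i) (hdV0 : ∀ i, dV i ≠ 0)
    (TW : Matrix (Fin 1) (Fin 1) (Fp L)) (hWd : IsUnit TW.det) (JW : Matrix (Fin 1) (Fin 1) L)
    (hJW : JW = TW.map (algebraMap (Fp L) L))
    (hd : (Matrix.reindex e₁ e₁ (Matrix.diagonal dV ⊗ₖ JW)).det ≠ 0) :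
    Liu2021.Def411WeilCarriersDoubling.CentralCharFactorsThroughDet (Fp L) L (IsCMField.complexConj L) 3 1 e₁
      (Matrix.diagonal dV) JW hd := by
  have h00 : JW 0 0 = algebraMap (Fp L) L (TW 0 0) := by
    rw [hJW, Matrix.map_apply]
  refine centralCharFactorsThroughDet_rank_three L e₁ dV hdV hdV0 JW ?_ ?_ hd
  · rw [h00]
    exact IsCMField.complexConj_apply_eq_self (K := L) (TW 0 0)
  · rw [h00]
    have hT : TW 0 0 ≠ 0 := by
      rw [Matrix.det_fin_one] at hWd
      exact hWd.ne_zero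
    exact fun h => hT ((algebraMap (Fp L) L).injective (h.trans (map_zero _).symm))

end Literature.NumberTheory.Automorphic.UnitaryGroup.AdelicCharactersDet

end
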